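import Literature.NumberTheory.EllipticCurves.TianYuanZhang2017.GenusPointDescentDisplays
import Literature.NumberTheory.EllipticCurves.TianYuanZhang2017.GenusDescentDefs
import HarnessLib

/-!
# Tian–Yuan–Zhang, W2 kernel: the brackets of the proof of Thm. 3.5 (2) as genus sums ("Brackets")

W2 (p2-lead ML-56; p2-monsky-lit GEN 8), file 4/6.  The four brackets of [TYZ, proof of Thm. 3.5 (2), p0020 L123–L165]
are written as DOUBLE sums over (decomposition `S ∈ decompositions n`, main block `d₀ ∈ S` in the sense of
p2-lit-1's displayed `MainBlock`) of `∏_{d ∈ S} g(d)` (`g = gK`, the display's reading of the genus class number in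
`GenusField`): `bFivePlain` (`d₀ ≡ 5`, no block `≡ 3`), `bFiveI` (`d₀ ≡ 5` with a block `≡ 3`, the `ε = ±i` type),
`bSix`, `bSeven`.  PROVED: residues of coprime products mod 8 (`mainBlock_cases`), the vanishing of the brackets of
the wrong type in each class, and the identification with the genus sums of Thm. 1.2 AS PRINTED:
`genusSum₂' n gK = bFivePlain n + bFiveI n + bSix n + bSeven n` (all `n`), `genusSum₁ n gK = bFivePlain n` (`n ≡ 5`),
`genusSum₁ n gK = bSeven n` (`n ≡ 7`).  No `def … : Prop`, no sorry.  HONEST FRAMING: finset arithmetic only;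
consumed by `UPlusOfGenusPointData` (file 6/6).

## References
* Y. Tian, X. Yuan, S.-W. Zhang, Asian J. Math. 21 (2017), arXiv:1411.4728, Thm. 1.2 (p0002 L115–L127), proof of
  Thm. 3.5 (2) (p0020 L123–L165). [TianYuanZhang2017]
-/

noncomputable section

open scoped Classical
open Finset

namespace Literature.NumberTheory.EllipticCurves.TianYuanZhang2017.W2

section Brackets

open Literature.NumberTheory.EllipticCurves
open Literature.NumberTheory.EllipticCurves.TianYuanZhang2017

/-! ### Brackets as double sums over (decomposition, main block) -/

/-! ### Uniqueness of the main block -/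

/-- A decomposition has at most one main block (the other blocks are `≡ 1, 2, 3`). [cite: TianYuanZhang2017, Thm. 1.2 (chunk p0002 L115–L127) and proof of Thm. 3.5 (2) (p0020 L123–L165)] -/
theorem mainBlock_unique {S : Finset ℕ} {a b : ℕ} (hb : b ∈ S)
    (hA : MainBlock S a) (hB : MainBlock S b) : a = b := by
  by_contra h
  have h1 := hA.2.1 b hb (Ne.symm h)
  rcases hB.1 with h' | h' | h' <;> omega

/-- A sum over the (at most one) main block of `S` is an `if`. [cite: TianYuanZhang2017, Thm. 1.2 (chunk p0002 L115–L127) and proof of Thm. 3.5 (2) (p0020 L123–L165)] -/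
theorem sum_mainBlock_ite {M : Type*} [AddCommMonoid M] (S : Finset ℕ) (Q : ℕ → Prop) (w : M) :
    (∑ d₀ ∈ S.filter (fun d₀ => MainBlock S d₀), if Q d₀ then w else 0) =
      if ∃ d₀ ∈ S, MainBlock S d₀ ∧ Q d₀ then w else 0 := by
  by_cases hex : ∃ a ∈ S, MainBlock S a
  · obtain ⟨a, haS, haM⟩ := hex
    have hfa : S.filter (fun d₀ => MainBlock S d₀) = {a} := by
      refine Finset.eq_singleton_iff_unique_mem.mpr ⟨Finset.mem_filter.mpr ⟨haS, haM⟩, fun b hb => ?_⟩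
      exact (mainBlock_unique (Finset.mem_filter.mp hb).1 haM (Finset.mem_filter.mp hb).2).symm
    rw [hfa, Finset.sum_singleton]
    by_cases hQ : Q a
    · rw [if_pos hQ, if_pos ⟨a, haS, haM, hQ⟩]
    · rw [if_neg hQ, if_neg]
      rintro ⟨b, hbS, hbM, hbQ⟩
      exact hQ (mainBlock_unique hbS haM hbM ▸ hbQ)
  · have hfa : S.filter (fun d₀ => MainBlock S d₀) = ∅ :=
      Finset.filter_eq_empty_iff.mpr fun a ha hM => hex ⟨a, ha, hM⟩
    rw [hfa, Finset.sum_empty, if_neg]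
    rintro ⟨b, hbS, hbM, -⟩
    exact hex ⟨b, hbS, hbM⟩

/-- A constant summed over the (at most one) main block of `S`. [cite: TianYuanZhang2017, Thm. 1.2 (chunk p0002 L115–L127) and proof of Thm. 3.5 (2) (p0020 L123–L165)] -/
theorem sum_mainBlock_const {M : Type*} [AddCommMonoid M] (S : Finset ℕ) (w : M) :
    (∑ _d₀ ∈ S.filter (fun d₀ => MainBlock S d₀), w) = if ∃ d₀ ∈ S, MainBlock S d₀ then w else 0 := by
  by_cases hex : ∃ a ∈ S, MainBlock S a
  · obtain ⟨a, haS, haM⟩ := hex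
    have hfa : S.filter (fun d₀ => MainBlock S d₀) = {a} := by
      refine Finset.eq_singleton_iff_unique_mem.mpr ⟨Finset.mem_filter.mpr ⟨haS, haM⟩, fun b hb => ?_⟩
      exact (mainBlock_unique (Finset.mem_filter.mp hb).1 haM (Finset.mem_filter.mp hb).2).symm
    rw [hfa, Finset.sum_singleton, if_pos ⟨a, haS, haM⟩]
  · have hfa : S.filter (fun d₀ => MainBlock S d₀) = ∅ :=
      Finset.filter_eq_empty_iff.mpr fun a ha hM => hex ⟨a, ha, hM⟩
    rw [hfa, Finset.sum_empty, if_neg hex]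

/-- A bracket as a single filtered sum over decompositions. [cite: TianYuanZhang2017, Thm. 1.2 (chunk p0002 L115–L127) and proof of Thm. 3.5 (2) (p0020 L123–L165)] -/
theorem coef_eq_sum_filter (n : ℕ) (Q : Finset ℕ → ℕ → Prop) :
    coef n Q = ∑ S ∈ (decompositions n).filter (fun S => ∃ d₀ ∈ S, MainBlock S d₀ ∧ Q S d₀),
      ∏ d ∈ S, gK d := by
  rw [coef, Finset.sum_filter]
  exact Finset.sum_congr rfl fun S _ => sum_mainBlock_ite S (Q S) _

/-! ### Residues of coprime products mod 8 -/

/-- A product of numbers `≡ 1 (mod 8)` is `≡ 1 (mod 8)`. [cite: TianYuanZhang2017, Thm. 1.2 (chunk p0002 L115–L127) and proof of Thm. 3.5 (2) (p0020 L123–L165)] -/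
theorem prod_mod_eight_eq_one {T : Finset ℕ} (h : ∀ d ∈ T, d % 8 = 1) : (∏ d ∈ T, d) % 8 = 1 := by
  rw [Finset.prod_nat_mod, Finset.prod_congr rfl h]; simp

/-- A product of numbers `≡ 1 (mod 8)` except one factor `e` is `≡ e (mod 8)`. [cite: TianYuanZhang2017, Thm. 1.2 (chunk p0002 L115–L127) and proof of Thm. 3.5 (2) (p0020 L123–L165)] -/
theorem prod_mod_eight_of_exception {T : Finset ℕ} {e : ℕ} (he : e ∈ T)
    (h : ∀ d ∈ T, d ≠ e → d % 8 = 1) : (∏ d ∈ T, d) % 8 = e % 8 := by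
  rw [← Finset.mul_prod_erase T (fun d => d) he, Nat.mul_mod,
    prod_mod_eight_eq_one fun d hd => h d (Finset.mem_of_mem_erase hd) (Finset.ne_of_mem_erase hd)]
  simp

/-- The blocks of a decomposition of `n` multiply to `n`. [cite: TianYuanZhang2017, Thm. 1.2 (chunk p0002 L115–L127) and proof of Thm. 3.5 (2) (p0020 L123–L165)] -/
theorem prod_eq_of_mem_decompositions {n : ℕ} {S : Finset ℕ} (hS : S ∈ decompositions n) :
    ∏ d ∈ S, d = n := by
  simp only [decompositions, Finset.mem_filter] at hS
  exact hS.2.2.2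

/-- A block of a decomposition of `n` divides `n`. [cite: TianYuanZhang2017, Thm. 1.2 (chunk p0002 L115–L127) and proof of Thm. 3.5 (2) (p0020 L123–L165)] -/
theorem dvd_of_mem_decompositions {n : ℕ} {S : Finset ℕ} (hS : S ∈ decompositions n) {d : ℕ}
    (hd : d ∈ S) : d ∣ n := by
  rw [← prod_eq_of_mem_decompositions hS]; exact Finset.dvd_prod_of_mem _ hd

/-- The two shapes of a decomposition with a main block `d₀`: either all other blocks are `≡ 1` and
`n ≡ d₀ (mod 8)`, or exactly one other block `e ≡ 2, 3` and `n ≡ d₀e (mod 8)`. [cite: TianYuanZhang2017, Thm. 1.2 (chunk p0002 L115–L127) and proof of Thm. 3.5 (2) (p0020 L123–L165)] -/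
theorem mainBlock_cases {n : ℕ} {S : Finset ℕ} (hS : S ∈ decompositions n) {d₀ : ℕ} (hd₀ : d₀ ∈ S)
    (hM : MainBlock S d₀) :
    (n % 8 = d₀ % 8 ∧ ∀ d ∈ S, d ≠ d₀ → d % 8 = 1) ∨
    (∃ e ∈ S, e ≠ d₀ ∧ (e % 8 = 2 ∨ e % 8 = 3) ∧ n % 8 = (d₀ % 8 * (e % 8)) % 8 ∧
      ∀ d ∈ S, d ≠ d₀ → d ≠ e → d % 8 = 1) := by
  obtain ⟨-, hothers, hcard⟩ := hM
  have hn : n = d₀ * ∏ d ∈ S.erase d₀, d := by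
    rw [Finset.mul_prod_erase S (fun d => d) hd₀, prod_eq_of_mem_decompositions hS]
  by_cases hT : ((S.erase d₀).filter fun d => d % 8 ≠ 1).Nonempty
  · obtain ⟨e, he⟩ := hT
    have he' := Finset.mem_filter.mp he
    have heS : e ∈ S := Finset.mem_of_mem_erase he'.1
    have hne : e ≠ d₀ := Finset.ne_of_mem_erase he'.1
    have hrest : ∀ d ∈ S, d ≠ d₀ → d ≠ e → d % 8 = 1 := by
      intro d hd hd0 hde
      by_contra h1
      exact hde (Finset.card_le_one.mp hcard d (Finset.mem_filter.mpr ⟨Finset.mem_erase.mpr ⟨hd0, hd⟩, h1⟩) e he)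
    right
    refine ⟨e, heS, hne, ?_, ?_, hrest⟩
    · rcases hothers e heS hne with h | h | h
      · exact absurd h he'.2
      · exact Or.inl h
      · exact Or.inr h
    · rw [hn, Nat.mul_mod, prod_mod_eight_of_exception he'.1 fun d hd hde =>
        hrest d (Finset.mem_of_mem_erase hd) (Finset.ne_of_mem_erase hd) hde]
  · rw [Finset.not_nonempty_iff_eq_empty, Finset.filter_eq_empty_iff] at hT
    have hall : ∀ d ∈ S, d ≠ d₀ → d % 8 = 1 := fun d hd hd0 => by
      have := hT (Finset.mem_erase.mpr ⟨hd0, hd⟩); tauto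
    left
    refine ⟨?_, hall⟩
    rw [hn, Nat.mul_mod, prod_mod_eight_eq_one fun d hd =>
      hall d (Finset.mem_of_mem_erase hd) (Finset.ne_of_mem_erase hd)]
    simp

/-! ### Class consequences -/

/-- The blocks of a decomposition of an odd `n` are odd. [cite: TianYuanZhang2017, Thm. 1.2 (chunk p0002 L115–L127) and proof of Thm. 3.5 (2) (p0020 L123–L165)] -/
theorem odd_of_mem_decompositions {n : ℕ} (hn : Odd n) {S : Finset ℕ} (hS : S ∈ decompositions n)
    {d : ℕ} (hd : d ∈ S) : d % 2 = 1 :=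
  Nat.odd_iff.mp (hn.of_dvd_nat (dvd_of_mem_decompositions hS hd))

/-- `n ≡ 5`: a main block `≡ 5` has all other blocks `≡ 1`. [cite: TianYuanZhang2017, Thm. 1.2 (chunk p0002 L115–L127) and proof of Thm. 3.5 (2) (p0020 L123–L165)] -/
theorem others_one_of_five_five {n : ℕ} (h5 : n % 8 = 5) {S : Finset ℕ} (hS : S ∈ decompositions n)
    {d₀ : ℕ} (hd₀ : d₀ ∈ S) (hM : MainBlock S d₀) (hd5 : d₀ % 8 = 5) :
    ∀ d ∈ S, d ≠ d₀ → d % 8 = 1 := by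
  rcases mainBlock_cases hS hd₀ hM with ⟨-, h⟩ | ⟨e, -, -, he23, hne, -⟩
  · exact h
  · exfalso; rw [hd5] at hne; rcases he23 with h | h <;> rw [h] at hne <;> omega

/-- `n ≡ 7`: a main block `≡ 7` has all other blocks `≡ 1`. [cite: TianYuanZhang2017, Thm. 1.2 (chunk p0002 L115–L127) and proof of Thm. 3.5 (2) (p0020 L123–L165)] -/
theorem others_one_of_seven_seven {n : ℕ} (h7 : n % 8 = 7) {S : Finset ℕ} (hS : S ∈ decompositions n)
    {d₀ : ℕ} (hd₀ : d₀ ∈ S) (hM : MainBlock S d₀) (hd7 : d₀ % 8 = 7) :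
    ∀ d ∈ S, d ≠ d₀ → d % 8 = 1 := by
  rcases mainBlock_cases hS hd₀ hM with ⟨-, h⟩ | ⟨e, -, -, he23, hne, -⟩
  · exact h
  · exfalso; rw [hd7] at hne; rcases he23 with h | h <;> rw [h] at hne <;> omega

/-- `n ≡ 7`: a main block `≡ 5` comes with a block `≡ 3`. [cite: TianYuanZhang2017, Thm. 1.2 (chunk p0002 L115–L127) and proof of Thm. 3.5 (2) (p0020 L123–L165)] -/
theorem exists_three_of_seven_five {n : ℕ} (h7 : n % 8 = 7) {S : Finset ℕ} (hS : S ∈ decompositions n)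
    {d₀ : ℕ} (hd₀ : d₀ ∈ S) (hM : MainBlock S d₀) (hd5 : d₀ % 8 = 5) : ∃ d ∈ S, d % 8 = 3 := by
  rcases mainBlock_cases hS hd₀ hM with ⟨h, -⟩ | ⟨e, heS, -, he23, hne, -⟩
  · omega
  · rw [hd5] at hne
    rcases he23 with h | h
    · rw [h] at hne; omega
    · exact ⟨e, heS, h⟩

/-- `n ≡ 5`: a main block `≡ 5` comes with NO block `≡ 3`. [cite: TianYuanZhang2017, Thm. 1.2 (chunk p0002 L115–L127) and proof of Thm. 3.5 (2) (p0020 L123–L165)] -/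
theorem not_exists_three_of_five_five {n : ℕ} (h5 : n % 8 = 5) {S : Finset ℕ} (hS : S ∈ decompositions n)
    {d₀ : ℕ} (hd₀ : d₀ ∈ S) (hM : MainBlock S d₀) (hd5 : d₀ % 8 = 5) : ¬ ∃ d ∈ S, d % 8 = 3 := by
  rintro ⟨d, hd, hd3⟩
  have h := others_one_of_five_five h5 hS hd₀ hM hd5
  by_cases hdd : d = d₀
  · omega
  · have := h d hd hdd; omega

/-- `n ≡ 6`: no main block is `≡ 5`. [cite: TianYuanZhang2017, Thm. 1.2 (chunk p0002 L115–L127) and proof of Thm. 3.5 (2) (p0020 L123–L165)] -/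
theorem not_five_of_six {n : ℕ} (h6 : n % 8 = 6) {S : Finset ℕ} (hS : S ∈ decompositions n)
    {d₀ : ℕ} (hd₀ : d₀ ∈ S) (hM : MainBlock S d₀) : d₀ % 8 ≠ 5 := by
  intro hd5
  rcases mainBlock_cases hS hd₀ hM with ⟨h, -⟩ | ⟨e, -, -, he23, hne, -⟩
  · omega
  · rw [hd5] at hne; rcases he23 with h | h <;> rw [h] at hne <;> omega

/-- `n ≡ 6`: a main block `≡ 6` has all other blocks `≡ 1`, hence `d₀ ≡ n (mod 16)`. [cite: TianYuanZhang2017, Thm. 1.2 (chunk p0002 L115–L127) and proof of Thm. 3.5 (2) (p0020 L123–L165)] -/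
theorem mod_sixteen_of_six_six {n : ℕ} (h6 : n % 8 = 6) {S : Finset ℕ} (hS : S ∈ decompositions n)
    {d₀ : ℕ} (hd₀ : d₀ ∈ S) (hM : MainBlock S d₀) (hd6 : d₀ % 8 = 6) : d₀ % 16 = n % 16 := by
  rcases mainBlock_cases hS hd₀ hM with ⟨-, hall⟩ | ⟨e, -, -, he23, hne, -⟩
  · have hn : n = d₀ * ∏ d ∈ S.erase d₀, d := by
      rw [Finset.mul_prod_erase S (fun d => d) hd₀, prod_eq_of_mem_decompositions hS]
    have hc : (∏ d ∈ S.erase d₀, d) % 8 = 1 := prod_mod_eight_eq_one fun d hd =>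
      hall d (Finset.mem_of_mem_erase hd) (Finset.ne_of_mem_erase hd)
    set c := ∏ d ∈ S.erase d₀, d
    obtain ⟨k, hk⟩ : ∃ k, c = 8 * k + 1 := ⟨c / 8, by omega⟩
    obtain ⟨j, hj⟩ : ∃ j, d₀ = 2 * j := ⟨d₀ / 2, by omega⟩
    rw [hn, hk, hj]; ring_nf; omega
  · exfalso; rw [hd6] at hne; rcases he23 with h | h <;> rw [h] at hne <;> omega

/-! ### Vanishing of the brackets of the wrong type -/

/-- A bracket none of whose (decomposition, main block) pairs has the required type vanishes. [cite: TianYuanZhang2017, Thm. 1.2 (chunk p0002 L115–L127) and proof of Thm. 3.5 (2) (p0020 L123–L165)] -/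
theorem coef_eq_zero {n : ℕ} {Q : Finset ℕ → ℕ → Prop}
    (h : ∀ S ∈ decompositions n, ∀ d₀ ∈ S, MainBlock S d₀ → ¬ Q S d₀) : coef n Q = 0 := by
  refine Finset.sum_eq_zero fun S hS => Finset.sum_eq_zero fun d₀ hd₀ => ?_
  rw [Finset.mem_filter] at hd₀
  rw [if_neg (h S hS d₀ hd₀.1 hd₀.2)]

/-- `n ≡ 5 (mod 8)`: `B₅ᵢ = 0` (a main block `≡ 5` has no companion `≡ 3`). [cite: TianYuanZhang2017, Thm. 1.2 (chunk p0002 L115–L127) and proof of Thm. 3.5 (2) (p0020 L123–L165)] -/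
theorem bFiveI_eq_zero_of_five {n : ℕ} (h5 : n % 8 = 5) : bFiveI n = 0 :=
  coef_eq_zero fun _ hS _ hd₀ hM hQ => not_exists_three_of_five_five h5 hS hd₀ hM hQ.1 hQ.2

/-- `n ≡ 7 (mod 8)`: `B₅ = 0` (a main block `≡ 5` forces a companion `≡ 3`). [cite: TianYuanZhang2017, Thm. 1.2 (chunk p0002 L115–L127) and proof of Thm. 3.5 (2) (p0020 L123–L165)] -/
theorem bFivePlain_eq_zero_of_seven {n : ℕ} (h7 : n % 8 = 7) : bFivePlain n = 0 :=
  coef_eq_zero fun _ hS _ hd₀ hM hQ => hQ.2 (exists_three_of_seven_five h7 hS hd₀ hM hQ.1)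

/-- `n` odd: `B₆ = 0` (no even block). [cite: TianYuanZhang2017, Thm. 1.2 (chunk p0002 L115–L127) and proof of Thm. 3.5 (2) (p0020 L123–L165)] -/
theorem bSix_eq_zero_of_odd {n : ℕ} (hn : Odd n) : bSix n = 0 :=
  coef_eq_zero fun _ hS _ hd₀ _ hQ => by
    have := odd_of_mem_decompositions hn hS hd₀; unfold QSix at hQ; omega

/-- `n ≡ 6 (mod 8)`: `B₅ = 0` (no main block `≡ 5`). [cite: TianYuanZhang2017, Thm. 1.2 (chunk p0002 L115–L127) and proof of Thm. 3.5 (2) (p0020 L123–L165)] -/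
theorem bFivePlain_eq_zero_of_six {n : ℕ} (h6 : n % 8 = 6) : bFivePlain n = 0 :=
  coef_eq_zero fun _ hS _ hd₀ hM hQ => not_five_of_six h6 hS hd₀ hM hQ.1

/-- `n ≡ 6 (mod 8)`: `B₅ᵢ = 0` (no main block `≡ 5`). [cite: TianYuanZhang2017, Thm. 1.2 (chunk p0002 L115–L127) and proof of Thm. 3.5 (2) (p0020 L123–L165)] -/
theorem bFiveI_eq_zero_of_six {n : ℕ} (h6 : n % 8 = 6) : bFiveI n = 0 :=
  coef_eq_zero fun _ hS _ hd₀ hM hQ => not_five_of_six h6 hS hd₀ hM hQ.1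

/-! ### The genus sums as brackets -/

/-- `Σ₂′ = B₅ + B₅ᵢ + B₆ + B₇` (every `n`). [cite: TianYuanZhang2017, Thm. 1.2 (chunk p0002 L115–L127) and proof of Thm. 3.5 (2) (p0020 L123–L165)] -/
theorem genusSum₂'_eq_brackets (n : ℕ) :
    genusSum₂' n gK = bFivePlain n + bFiveI n + bSix n + bSeven n := by
  have hR : bFivePlain n + bFiveI n + bSix n + bSeven n =
      ∑ S ∈ decompositions n, ∑ _d₀ ∈ S.filter (fun d₀ => MainBlock S d₀), ∏ d ∈ S, gK d := by
    simp only [bFivePlain, bFiveI, bSix, bSeven, coef, ← Finset.sum_add_distrib]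
    refine Finset.sum_congr rfl fun S _ => Finset.sum_congr rfl fun d₀ hd₀ => ?_
    have h567 : d₀ % 8 = 5 ∨ d₀ % 8 = 6 ∨ d₀ % 8 = 7 := (Finset.mem_filter.mp hd₀).2.1
    by_cases h3 : ∃ d ∈ S, d % 8 = 3
    · rcases h567 with h | h | h <;> simp [QFivePlain, QFiveI, QSix, QSeven, h, h3]
    · rcases h567 with h | h | h <;> simp [QFivePlain, QFiveI, QSix, QSeven, h, h3]
  rw [hR, Finset.sum_congr rfl fun S _ => sum_mainBlock_const S _, ← Finset.sum_filter, genusSum₂']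
  exact Finset.sum_congr (Finset.filter_congr fun D _ => by simp only [MainBlock]) fun _ _ => rfl

/-- For `n ≢ 1 (mod 8)`: the `Σ₁`-condition "at most one block `≢ 1`" means "exactly one block `d* ≢ 1`,
with `d* ≡ n (mod 8)`". [cite: TianYuanZhang2017, Thm. 1.2 (chunk p0002 L115–L127) and proof of Thm. 3.5 (2) (p0020 L123–L165)] -/
theorem sigma1_filter_iff {n : ℕ} (hn1 : n % 8 ≠ 1) {D : Finset ℕ} (hD : D ∈ decompositions n) :
    (D.filter fun d => d % 8 ≠ 1).card ≤ 1 ↔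
      ∃ e ∈ D, e % 8 = n % 8 ∧ ∀ d ∈ D, d ≠ e → d % 8 = 1 := by
  constructor
  · intro hcard
    by_cases hT : (D.filter fun d => d % 8 ≠ 1).Nonempty
    · obtain ⟨e, he⟩ := hT
      have heD : e ∈ D := (Finset.mem_filter.mp he).1
      have hrest : ∀ d ∈ D, d ≠ e → d % 8 = 1 := by
        intro d hd hde
        by_contra h1
        exact hde (Finset.card_le_one.mp hcard d (Finset.mem_filter.mpr ⟨hd, h1⟩) e he)
      refine ⟨e, heD, ?_, hrest⟩
      rw [← prod_eq_of_mem_decompositions hD, prod_mod_eight_of_exception heD hrest]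
    · rw [Finset.not_nonempty_iff_eq_empty, Finset.filter_eq_empty_iff] at hT
      exfalso; apply hn1
      rw [← prod_eq_of_mem_decompositions hD, prod_mod_eight_eq_one fun d hd => by have := hT hd; tauto]
  · rintro ⟨e, heD, -, hrest⟩
    refine Finset.card_le_one.mpr fun a ha b hb => ?_
    have ha' := Finset.mem_filter.mp ha
    have hb' := Finset.mem_filter.mp hb
    have hae : a = e := by by_contra h; exact ha'.2 (hrest a ha'.1 h)
    have hbe : b = e := by by_contra h; exact hb'.2 (hrest b hb'.1 h)
    rw [hae, hbe]

/-- `n ≡ 5`: `Σ₁ = B₅` (plain type). [cite: TianYuanZhang2017, Thm. 1.2 (chunk p0002 L115–L127) and proof of Thm. 3.5 (2) (p0020 L123–L165)] -/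
theorem genusSum₁_eq_bFivePlain {n : ℕ} (h5 : n % 8 = 5) : genusSum₁ n gK = bFivePlain n := by
  rw [bFivePlain, coef_eq_sum_filter, genusSum₁]
  refine Finset.sum_congr (Finset.filter_congr fun D hD => ?_) fun _ _ => rfl
  rw [sigma1_filter_iff (by omega) hD]
  constructor
  · rintro ⟨e, heD, he5, hrest⟩
    rw [h5] at he5
    have hM : MainBlock D e :=
      ⟨Or.inl he5, fun d hd hde => Or.inl (hrest d hd hde), Finset.card_le_one.mpr fun a ha b hb => by
        have ha' := Finset.mem_filter.mp ha
        exact absurd (hrest a (Finset.mem_of_mem_erase ha'.1) (Finset.ne_of_mem_erase ha'.1)) ha'.2⟩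
    exact ⟨e, heD, hM, he5, not_exists_three_of_five_five h5 hD heD hM he5⟩
  · rintro ⟨e, heD, hM, he5, -⟩
    exact ⟨e, heD, by omega, others_one_of_five_five h5 hD heD hM he5⟩

/-- `n ≡ 7`: `Σ₁ = B₇`. [cite: TianYuanZhang2017, Thm. 1.2 (chunk p0002 L115–L127) and proof of Thm. 3.5 (2) (p0020 L123–L165)] -/
theorem genusSum₁_eq_bSeven {n : ℕ} (h7 : n % 8 = 7) : genusSum₁ n gK = bSeven n := by
  rw [bSeven, coef_eq_sum_filter, genusSum₁]
  refine Finset.sum_congr (Finset.filter_congr fun D hD => ?_) fun _ _ => rfl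
  rw [sigma1_filter_iff (by omega) hD]
  constructor
  · rintro ⟨e, heD, he7, hrest⟩
    rw [h7] at he7
    have hM : MainBlock D e :=
      ⟨Or.inr (Or.inr he7), fun d hd hde => Or.inl (hrest d hd hde), Finset.card_le_one.mpr fun a ha b hb => by
        have ha' := Finset.mem_filter.mp ha
        exact absurd (hrest a (Finset.mem_of_mem_erase ha'.1) (Finset.ne_of_mem_erase ha'.1)) ha'.2⟩
    exact ⟨e, heD, hM, he7⟩
  · rintro ⟨e, heD, hM, he7⟩
    exact ⟨e, heD, by unfold QSeven at he7; omega, others_one_of_seven_seven h7 hD heD hM he7⟩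

end Brackets

end Literature.NumberTheory.EllipticCurves.TianYuanZhang2017.W2
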